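import Summits.QuantumFields.YangMills.Theorems.SwapVirialDeficitZeroModeSigmaFourSmallBallLimit
import HarnessLib

/-!
# Exact zero-mode rung Z5 — the σ-TWISTED FOUR-LEADER small ball, VI: the canonical constant `v₇ = coneConst³·∫ vol³(limSigma 1 A(a)) dcone(a)`
# (LEAD ym-line-sfw-p2 g93 07:46Z «… with explicit v's = integrals over the commuting-triple cone»; free-hands support of ⟨stmt-QuantumFields-24197⟩)

Part V proved `Haar⁴(E_σ(t))/t⁷ → v₇ > 0` with `v₇ = r⁻⁷·coneConst³·μ(limit event at threshold r)` for an auxiliary good threshold `r`.  Here the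
threshold is removed: the six derivatives `L_i` are LINEAR under the blow-up dilation `(D_r × D_r) × D³_r` of the letters (`Lrel_dil3`), so
`limSigma r A = (dil3 r⁻¹)⁻¹(limSigma 1 A)` and `vol³(limSigma r A) = r⁷·vol³(limSigma 1 A)` EXACTLY (✓`Measure.addHaar_preimage_linearMap`), whence
★★★ `sigmaBall_smallBall_limit_eq : Tendsto (Haar⁴(sigmaBall t)/t⁷) (𝓝[>] 0) (𝓝 sigmaV)` with the CANONICAL constant
`sigmaV = (coneConst³ · ∫ vol³(limSigma 1 (radialUnit (axisPoint a))) dcone(a)).toReal > 0` — an explicit integral over the cone model of the hub of the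
Lebesgue volume of the limit event `{‖x̄‖,‖ȳ‖,|z₀| < 1, z₀ > 0, ‖L_i‖ ≤ 1}` of part III-b.
HONEST LABEL: a finite-dimensional Haar-volume asymptotic on `SU(2)⁴` (plan-level zero-mode rung of the DRAFT line «sharp-sigma»); NOT the fixed-`L`
sharp law, NOT ⟨24197⟩; no rate claimed; own crux ⟨22884⟩ OPEN (blocked-on ⟨19935⟩); the Yang–Mills mass gap is NOT proved; no summit is proved by a line.
Width seat ym-line-sfw-p2-w3 g63 (cell ym-idea-1, free hands), `--supports stmt-QuantumFields-24197`.  Standard axioms, 0 `sorry`.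
References: [cite: GonzalezarroyoAltes1988]; [cite: Vanbaal2001]; [cite: Luscher1983, §2]; [folklore].
-/

set_option autoImplicit false

noncomputable section

open MeasureTheory Quaternion Set Filter Topology
open scoped Quaternion ENNReal BigOperators
open Literature.MathematicalPhysics.QuantumLattice
open Literature.MathematicalPhysics.QuantumFieldTheory (haarProbability)
open Literature.Analysis.Calculus (radialUnit radialUnit_def norm_radialUnit tangentialProj)
open Summit.QuantumFields.YangMills.Theorems.SwapTwistDeficit.ToronLog
open Summit.QuantumFields.YangMills.Theorems.SwapVirialDeficit.ZeroModeGroup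

attribute [local instance] Literature.Analysis.FluidPDE.Tao2016.quatMeasurableSpace
  Literature.Analysis.FluidPDE.Tao2016.quatBorelSpace
  Literature.MathematicalPhysics.QuantumLattice.secondCountableTopology_su2

namespace Summit.QuantumFields.YangMills.Theorems.SwapVirialDeficit.ZeroModeSigma

/-! ## §34 The derivatives are linear under the blow-up dilation -/

/-- `D_r` fixes the axial part and scales the transversal part. [folklore] -/
theorem axPart_trPart_dilate (r : ℝ) (x : ℍ) : axPart (dilate r x) = axPart x ∧ trPart (dilate r x) = r • trPart x := by
  constructor
  · rw [dilate_apply]; rfl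
  · rw [dilate_apply]; ext <;> simp [trPart]

/-- `D³_r` fixes the real part and scales the imaginary part. [folklore] -/
theorem re_im_dilateIm (r : ℝ) (z : ℍ) : (dilateIm r z).re = z.re ∧ (dilateIm r z).im = r • z.im := by
  constructor
  · rw [dilateIm_re]
  · rw [dilateIm_apply]; ext <;> simp

/-- `Xd (D_r x) = r·Xd x`. [folklore] -/
theorem Xd_dilate (r : ℝ) (x : ℍ) : Xd (dilate r x) = r • Xd x := by
  obtain ⟨ha, ht⟩ := axPart_trPart_dilate r x
  unfold Xd
  rw [ha, ht, map_smul]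

/-- `Zd (D³_r z) = r·Zd z`. [folklore] -/
theorem Zd_dilateIm (r : ℝ) (z : ℍ) : Zd (dilateIm r z) = r • Zd z := by
  obtain ⟨hre, him⟩ := re_im_dilateIm r z
  unfold Zd
  rw [hre, him, map_smul]

/-- `X(0)` is unchanged by the dilation. [folklore] -/
theorem Xp_zero_dilate (r : ℝ) (x : ℍ) : Xp (dilate r x) 0 = Xp x 0 := by
  rw [Xp_zero, Xp_zero, (axPart_trPart_dilate r x).1]

/-- `W(0)` is unchanged by the dilation. [folklore] -/
theorem Wp_zero_dilate (A : ℍ) (r : ℝ) (x z : ℍ) : Wp A (dilate r x) (dilateIm r z) 0 = Wp A x z 0 := by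
  rw [Wp_zero, Wp_zero, (axPart_trPart_dilate r x).1, (re_im_dilateIm r z).1]

/-- `Wd` scales by `r`. [folklore] -/
theorem Wd_dilate (A : ℍ) (r : ℝ) (x z : ℍ) : Wd A (dilate r x) (dilateIm r z) = r • Wd A x z := by
  unfold Wd
  rw [Xd_dilate, Zd_dilateIm, (axPart_trPart_dilate r x).1, (re_im_dilateIm r z).1, smul_add]
  simp only [mul_smul_comm, smul_mul_assoc]

/-- ★ **The six derivatives are linear under the blow-up dilation**: `L_i(D_r x, D_r y, D³_r z) = r·L_i(x, y, z)`. [folklore] -/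
theorem Lrel_dil3 (A : ℍ) (r : ℝ) (x y z : ℍ) (i : Fin 6) :
    Lrel A (dilate r x) (dilate r y) (dilateIm r z) i = r • Lrel A x y z i := by
  have hX := Xd_dilate r x
  have hY := Xd_dilate r y
  have hW := Wd_dilate A r x z
  have hX0 := Xp_zero_dilate r x
  have hY0 := Xp_zero_dilate r y
  have hW0 := Wp_zero_dilate A r x z
  match i with
  | 0 => simp only [Lrel, hX, hW, hX0, hW0, smul_mul_assoc, mul_smul_comm, smul_add, smul_sub]
  | 1 => simp only [Lrel, hX, hY, hX0, hY0, smul_mul_assoc, mul_smul_comm, smul_add, smul_sub]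
  | 2 => simp only [Lrel, hY, hW, hY0, hW0, smul_mul_assoc, mul_smul_comm, smul_add, smul_sub]
  | 3 => simp only [Lrel, hX, hW, smul_mul_assoc, mul_smul_comm, smul_sub]
  | 4 => simp only [Lrel, hX, hW, smul_mul_assoc, mul_smul_comm, smul_sub]
  | 5 => simp only [Lrel, hY, smul_mul_assoc, mul_smul_comm, smul_sub]

/-! ## §35 The limit event scales exactly -/

/-- ★ **`limSigma r A = (dil3 r⁻¹)⁻¹(limSigma 1 A)`** for `r > 0`. [folklore] -/
theorem limSigma_eq_preimage {r : ℝ} (hr : 0 < r) (A : ℍ) : limSigma r A = (dil3 r⁻¹) ⁻¹' (limSigma 1 A) := by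
  ext w
  rw [Set.mem_preimage, mem_limSigma_iff, mem_limSigma_iff, dil3_apply]
  simp only [Lrel_dil3, (axPart_trPart_dilate r⁻¹ _).1, (re_im_dilateIm r⁻¹ _).1, norm_smul, Real.norm_eq_abs, abs_of_pos (inv_pos.2 hr)]
  have key : ∀ u : ℝ, u ≤ r ↔ r⁻¹ * u ≤ 1 := fun u => by rw [inv_mul_le_iff₀ hr, mul_one]
  simp only [key]

/-- ★ **`vol³(limSigma r A) = r⁷·vol³(limSigma 1 A)`** for `r > 0` — the limit measure is `7`-homogeneous. [folklore] -/
theorem volume_limSigma_scale {r : ℝ} (hr : 0 < r) (A : ℍ) : vol3 (limSigma r A) = ENNReal.ofReal (r ^ 7) * vol3 (limSigma 1 A) := by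
  haveI := isAddHaarMeasure_volume3
  have hdet : LinearMap.det (dil3 r⁻¹) ≠ 0 := by rw [det_dil3]; positivity
  rw [limSigma_eq_preimage hr]
  change (volume : Measure ((ℍ × ℍ) × ℍ)) ((dil3 r⁻¹) ⁻¹' limSigma 1 A) = ENNReal.ofReal (r ^ 7) * (volume : Measure ((ℍ × ℍ) × ℍ)) (limSigma 1 A)
  rw [Measure.addHaar_preimage_linearMap (μ := (volume : Measure ((ℍ × ℍ) × ℍ))) hdet, det_dil3, inv_pow, inv_inv,
    abs_of_pos (by positivity : (0:ℝ) < r ^ 7)]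

/-! ## §36 The canonical constant -/

/-- ★ **The σ-twisted small-ball constant** `v₇ = (coneConst³ · ∫ vol³(limSigma 1 (A(a))) dcone(a)).toReal`. [folklore] -/
def sigmaV : ℝ := (ENNReal.ofReal coneConst ^ 3 * ∫⁻ a, vol3 (limSigma 1 (radialUnit (axisPoint a))) ∂coneMeasure).toReal

/-- Unfolding `sigmaV`. [folklore] -/
theorem sigmaV_def : sigmaV = (ENNReal.ofReal coneConst ^ 3 * ∫⁻ a, vol3 (limSigma 1 (radialUnit (axisPoint a))) ∂coneMeasure).toReal := rfl

/-- The limit mass at threshold `r` as a hub integral, and its scaling to threshold `1`. [folklore] -/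
theorem limSigma_mass_eq {r : ℝ} (hr : 0 < r) :
    ∫⁻ q, {q : ℍ × ((ℍ × ℍ) × ℍ) | q.2 ∈ limSigma r (radialUnit (axisPoint q.1))}.indicator (1 : ℍ × ((ℍ × ℍ) × ℍ) → ℝ≥0∞) q ∂blowUp =
      ENNReal.ofReal (r ^ 7) * ∫⁻ a, vol3 (limSigma 1 (radialUnit (axisPoint a))) ∂coneMeasure := by
  haveI := isProbabilityMeasure_coneMeasure
  haveI := sFinite_vol3
  rw [lintegral_indicator_one (measurableSet_limSigma_hub r), blowUp, Measure.prod_apply (measurableSet_limSigma_hub r)]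
  have e : ∀ a : ℍ, vol3 (Prod.mk a ⁻¹' {q : ℍ × ((ℍ × ℍ) × ℍ) | q.2 ∈ limSigma r (radialUnit (axisPoint q.1))}) =
      ENNReal.ofReal (r ^ 7) * vol3 (limSigma 1 (radialUnit (axisPoint a))) := by
    intro a
    rw [show Prod.mk a ⁻¹' {q : ℍ × ((ℍ × ℍ) × ℍ) | q.2 ∈ limSigma r (radialUnit (axisPoint q.1))} = limSigma r (radialUnit (axisPoint a)) by ext w; rfl]
    exact volume_limSigma_scale hr _
  simp only [e]
  -- measurability of the threshold-1 hub integrand (section measure of the joint limit event)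
  have hm : Measurable fun a : ℍ => vol3 (limSigma 1 (radialUnit (axisPoint a))) := by
    have h := measurable_measure_prodMk_left (ν := vol3) (measurableSet_limSigma_hub 1)
    have e1 : (fun a : ℍ => vol3 (Prod.mk a ⁻¹' {q : ℍ × ((ℍ × ℍ) × ℍ) | q.2 ∈ limSigma 1 (radialUnit (axisPoint q.1))})) =
        fun a => vol3 (limSigma 1 (radialUnit (axisPoint a))) := by
      funext a; rfl
    rw [e1] at h; exact h
  rw [lintegral_const_mul _ hm]

/-- ★★★ **THE σ-TWISTED FOUR-LEADER SMALL-BALL LIMIT WITH ITS CANONICAL CONSTANT**: `Haar⁴(E_σ(t))/t⁷ → sigmaV` as `t → 0⁺`, and `0 < sigmaV`.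
[folklore] -/
theorem sigmaBall_smallBall_limit_eq :
    0 < sigmaV ∧ Tendsto (fun t : ℝ =>
      ((Measure.pi fun _ : Fin 4 => haarProbability (Matrix.specialUnitaryGroup (Fin 2) ℂ)) (sigmaBall t)).toReal / t ^ 7) (𝓝[>] (0:ℝ)) (𝓝 sigmaV) := by
  obtain ⟨r, hr0, hr1, hgood⟩ := exists_good_threshold
  have hT := tendsto_lintegral_rescaledSigmaR hr1 hgood
  rw [limSigma_mass_eq hr0] at hT
  set J : ℝ≥0∞ := ∫⁻ a, vol3 (limSigma 1 (radialUnit (axisPoint a))) ∂coneMeasure with hJ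
  have hJtop : J ≠ ∞ := by
    have h := limSigma_mass_ne_top hr1 hgood
    rw [limSigma_mass_eq hr0, ← hJ] at h
    intro hJ'
    rw [hJ', ENNReal.mul_top (by positivity : ENNReal.ofReal (r ^ 7) ≠ 0)] at h
    exact h rfl
  -- the scale `s = t/r → 0⁺`
  have hscale : Tendsto (fun t : ℝ => t / r) (𝓝[>] (0:ℝ)) (𝓝[>] (0:ℝ)) := by
    refine tendsto_nhdsWithin_iff.2 ⟨?_, ?_⟩
    · have h : Tendsto (fun t : ℝ => t / r) (𝓝 (0:ℝ)) (𝓝 (0 / r)) := (continuous_id.div_const r).tendsto 0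
      rw [zero_div] at h
      exact h.mono_left nhdsWithin_le_nhds
    · filter_upwards [self_mem_nhdsWithin] with t ht using div_pos ht hr0
  have hcomp : Tendsto (fun t : ℝ => ENNReal.ofReal coneConst ^ 3 * ∫⁻ a, vol3 (rescaledSigmaR r (t / r) (radialUnit (axisPoint a))) ∂coneMeasure)
      (𝓝[>] (0:ℝ)) (𝓝 (ENNReal.ofReal coneConst ^ 3 * (ENNReal.ofReal (r ^ 7) * J))) :=
    ENNReal.Tendsto.const_mul (hT.comp hscale) (Or.inr (ENNReal.pow_ne_top ENNReal.ofReal_ne_top))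
  have htop : ENNReal.ofReal coneConst ^ 3 * (ENNReal.ofReal (r ^ 7) * J) ≠ ∞ :=
    ENNReal.mul_ne_top (ENNReal.pow_ne_top ENNReal.ofReal_ne_top) (ENNReal.mul_ne_top ENNReal.ofReal_ne_top hJtop)
  have hreal := (ENNReal.tendsto_toReal htop).comp hcomp
  have hval : (r ^ 7)⁻¹ * (ENNReal.ofReal coneConst ^ 3 * (ENNReal.ofReal (r ^ 7) * J)).toReal = sigmaV := by
    rw [sigmaV_def, ← hJ, ENNReal.toReal_mul, ENNReal.toReal_mul, ENNReal.toReal_mul, ENNReal.toReal_ofReal (by positivity : (0:ℝ) ≤ r ^ 7)]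
    have hr7 : r ^ 7 ≠ 0 := by positivity
    field_simp
  have hlim : Tendsto (fun t : ℝ =>
      ((Measure.pi fun _ : Fin 4 => haarProbability (Matrix.specialUnitaryGroup (Fin 2) ℂ)) (sigmaBall t)).toReal / t ^ 7) (𝓝[>] (0:ℝ)) (𝓝 sigmaV) := by
    rw [← hval]
    refine (tendsto_congr' ?_).2 (hreal.const_mul ((r ^ 7)⁻¹))
    filter_upwards [self_mem_nhdsWithin] with t ht
    rw [haar_sigmaBall_div_eq_R hr0 ht]
    rfl
  -- positivity by uniqueness of the limit and part V (floor)
  obtain ⟨v, hv, hvT⟩ := sigmaBall_smallBall_limit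
  have heq : sigmaV = v := tendsto_nhds_unique hlim hvT
  exact ⟨heq ▸ hv, hlim⟩

/-- ★★★ The canonical form with the event written out as in ✓`haar_pi_sigmaTwisted_ge` / ✓`haar_pi_sigmaTwisted_le`. [folklore] -/
theorem haar_pi_sigmaTwisted_div_pow_seven_tendsto :
    Tendsto (fun t : ℝ =>
      ((Measure.pi fun _ : Fin 4 => haarProbability (Matrix.specialUnitaryGroup (Fin 2) ℂ))
        {C : Fin 4 → Matrix.specialUnitaryGroup (Fin 2) ℂ |
          (∀ μ ν : Fin 3, ‖su2Quat (C μ.castSucc) * su2Quat (C ν.castSucc) - su2Quat (C ν.castSucc) * su2Quat (C μ.castSucc)‖ ≤ t) ∧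
            ∀ μ : Fin 3, ‖su2Quat (C (Fin.last 3)) * su2Quat (C (Equiv.swap (0 : Fin 3) 1 μ).castSucc) -
              su2Quat (C μ.castSucc) * su2Quat (C (Fin.last 3))‖ ≤ t}).toReal / t ^ 7)
      (𝓝[>] (0:ℝ)) (𝓝 sigmaV) :=
  sigmaBall_smallBall_limit_eq.2

/-- `0 < sigmaV`. [folklore] -/
theorem sigmaV_pos : 0 < sigmaV := sigmaBall_smallBall_limit_eq.1

/-! ## §37 Sharp two-sided form for consumers -/

/-- ★★ **Sharp two-sided small-ball law of the σ-twisted block**: for every `ε > 0`, eventually as `t → 0⁺`,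
`(sigmaV − ε)·t⁷ ≤ Haar⁴(E_σ(t)) ≤ (sigmaV + ε)·t⁷` — the fixed constants of ✓`haar_pi_sigmaTwisted_two_sided` replaced by the exact one up to `ε`.
[folklore] -/
theorem sigmaBall_two_sided_sharp {ε : ℝ} (hε : 0 < ε) :
    ∀ᶠ t in 𝓝[>] (0:ℝ), (sigmaV - ε) * t ^ 7 ≤ ((Measure.pi fun _ : Fin 4 => haarProbability (Matrix.specialUnitaryGroup (Fin 2) ℂ)) (sigmaBall t)).toReal ∧
      ((Measure.pi fun _ : Fin 4 => haarProbability (Matrix.specialUnitaryGroup (Fin 2) ℂ)) (sigmaBall t)).toReal ≤ (sigmaV + ε) * t ^ 7 := by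
  have hT := sigmaBall_smallBall_limit_eq.2
  have hlo : ∀ᶠ t in 𝓝[>] (0:ℝ), sigmaV - ε < ((Measure.pi fun _ : Fin 4 => haarProbability (Matrix.specialUnitaryGroup (Fin 2) ℂ)) (sigmaBall t)).toReal / t ^ 7 :=
    hT.eventually (lt_mem_nhds (by linarith))
  have hhi : ∀ᶠ t in 𝓝[>] (0:ℝ), ((Measure.pi fun _ : Fin 4 => haarProbability (Matrix.specialUnitaryGroup (Fin 2) ℂ)) (sigmaBall t)).toReal / t ^ 7 < sigmaV + ε :=
    hT.eventually (gt_mem_nhds (by linarith))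
  filter_upwards [hlo, hhi, self_mem_nhdsWithin] with t h1 h2 ht
  have h7 : 0 < t ^ 7 := pow_pos ht 7
  rw [lt_div_iff₀ h7] at h1
  rw [div_lt_iff₀ h7] at h2
  exact ⟨h1.le, h2.le⟩

/-- The same in `Measure.real` form with the event written out as in ✓`haar_pi_sigmaTwisted_two_sided`. [folklore] -/
theorem haar_pi_sigmaTwisted_two_sided_sharp {ε : ℝ} (hε : 0 < ε) :
    ∀ᶠ t in 𝓝[>] (0:ℝ),
      (sigmaV - ε) * t ^ 7 ≤ (Measure.pi fun _ : Fin 4 => haarProbability (Matrix.specialUnitaryGroup (Fin 2) ℂ)).real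
          {C : Fin 4 → Matrix.specialUnitaryGroup (Fin 2) ℂ |
            (∀ μ ν : Fin 3, ‖su2Quat (C μ.castSucc) * su2Quat (C ν.castSucc) - su2Quat (C ν.castSucc) * su2Quat (C μ.castSucc)‖ ≤ t) ∧
              ∀ μ : Fin 3, ‖su2Quat (C (Fin.last 3)) * su2Quat (C (Equiv.swap (0 : Fin 3) 1 μ).castSucc) -
                su2Quat (C μ.castSucc) * su2Quat (C (Fin.last 3))‖ ≤ t} ∧
      (Measure.pi fun _ : Fin 4 => haarProbability (Matrix.specialUnitaryGroup (Fin 2) ℂ)).real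
          {C : Fin 4 → Matrix.specialUnitaryGroup (Fin 2) ℂ |
            (∀ μ ν : Fin 3, ‖su2Quat (C μ.castSucc) * su2Quat (C ν.castSucc) - su2Quat (C ν.castSucc) * su2Quat (C μ.castSucc)‖ ≤ t) ∧
              ∀ μ : Fin 3, ‖su2Quat (C (Fin.last 3)) * su2Quat (C (Equiv.swap (0 : Fin 3) 1 μ).castSucc) -
                su2Quat (C μ.castSucc) * su2Quat (C (Fin.last 3))‖ ≤ t} ≤ (sigmaV + ε) * t ^ 7 :=
  sigmaBall_two_sided_sharp hε


/-! ## §38b The constant made explicit: `coneConst = 2/π²`, so `sigmaV = (8/π⁶)·∫ vol³(limSigma 1 A(a)) dcone(a)` -/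

/-- ★ **`sigmaV` with its numerical prefactor**: `sigmaV = ((8/π⁶)·∫⁻ a, vol3 (limSigma 1 (radialUnit (axisPoint a))) ∂coneMeasure).toReal`
(the unit ball of `ℍ` has volume `π²/2`, ✓`volume_ball_quat`, so `coneConst = 2/π²`). [folklore] -/
theorem sigmaV_eq_explicit :
    sigmaV = (ENNReal.ofReal (8 / Real.pi ^ 6) * ∫⁻ a, vol3 (limSigma 1 (radialUnit (axisPoint a))) ∂coneMeasure).toReal := by
  have hπ : 0 < Real.pi ^ 2 / 2 := by positivity
  have hc : coneConst = 2 / Real.pi ^ 2 := by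
    rw [show coneConst = (((volume : Measure ℍ) (Metric.ball 0 1))⁻¹).toReal from rfl, Literature.MathematicalPhysics.QuantumLattice.volume_ball_quat,
      ENNReal.toReal_inv, ENNReal.toReal_ofReal hπ.le, inv_div]
  rw [sigmaV, hc, ← ENNReal.ofReal_pow (by positivity)]
  congr 3
  have hπ0 : Real.pi ≠ 0 := Real.pi_pos.ne'
  field_simp
  ring

end Summit.QuantumFields.YangMills.Theorems.SwapVirialDeficit.ZeroModeSigma

end
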